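import Literature.NumberTheory.Automorphic.HidaTowerDiamondCentre
import Literature.NumberTheory.Automorphic.HidaTowerDiamondContinuity
import Literature.NumberTheory.GaloisRepresentations.OrdinaryTwistedDeterminant
import Literature.NumberTheory.Automorphic.GlobalScalarApproximation
import Summits.Langlands.Langlands.Theses.SkinnerWilesDefectOne
import Literature.NumberTheory.Automorphic.OrdinaryCompletedCohomologyGL
import Summits.Langlands.Langlands.Theorems.ProModularOrdinaryClassical.Negative.PointsIntegral

/-!
# Stub `stub_centralDiamondWeight` of the line `top-degree-exact-control` (crux
# `SkinnerWilesDefectOne.ProModularOrdinaryClassical`, stmt-Langlands-12921)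

**The centre of the diamond character of an ordinary `ℚ̄_p`-point has weight `2 - k`.**  For `𝒰`
maximal above `p`, a continuous point `x : 𝕋^{S,ord}(𝒰) → ℚ̄_p` of Hida's ordinary Hecke algebra of
`GL₂/F` associated with `ρ`, Galois-ordinary of parallel weight `k ≥ 2` with exponent `m > 0` at every
`v ∣ p`: there is `N ≥ 1` with `(∏_{v ∣ p} x(⟨diag(û_v, û_v)⟩_v))^N = (N_{F/ℚ}(u)^{2-k})^N` for every
`u ∈ 𝓞 F` that is a unit above `p` (`û_v` its local images).

Proof (all inputs proved in the sibling `…Central*` files; no named fact):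
(A) global central elements act trivially on `H^•(GL₂(F), ·)` (`CentralCohomology`, `CentralHecke`),
so the factorisation `u·1 = D C y` of a principal scalar (`ScalarFactorisation`, `IntegralLevel`) gives
`∏_{v∣p} ⟨û⟩_v = ∏_{w ∣ u} (T_{w,2}⁻¹)^{ord_w u}` in `𝕋^{S,ord}(𝒰)` for GOOD `u` (`DiamondHeckeIdentity`);
(B) association: `det ρ(Frob_w) = q_w x(T_{w,2})` (`AssociationDet`); (C) the twisted determinant
`(det ρ · ε^{1-k})^m` is unramified at `p` (ordinarity) and has finite order on principal Frobenius
products (the tree's global class field theory, `TwistedDeterminant`), and `|N(u)| = ∏ q_w^{ord_w u}`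
(`NormSupport`): whence the claim for good `u` with an EVEN exponent (`GoodCase`); (D) a general `u`
is the `p`-adic limit of good ones (CRT, `Approximation`), both sides being continuous in `u`
(`DiamondContinuity`: `x` is continuous and `⟨·⟩_v` is locally constant levelwise; `N(u') ≡ N(u)
mod p^B`).  The hypotheses "`F` imaginary quadratic", "`p ≠ 2`", "`ρ` irreducible" of the registered
signature are not used. [folklore]

## Log (stub worker, 2026-08-16)

* Conventions re-derived from the tree: `(γ f)(xL) = f(ι(γ)⁻¹ xL)` (`coeffRepresentation_apply`), the
  Hecke operator of a normalising `g` is `f ↦ f(x g L)` (`heckeFun_apply_mk_of_conj`), so the action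
  of the global scalar `γ = u·1` on the coefficients IS `T_{ι(γ)⁻¹}`, and `T_{u·1} = 1` on every
  `H^i(X_{U(r)}, ℤ/p^s)`; with `u·1 = D C y` this gives `T_D = T_{C⁻¹}`, i.e.
  `∏_{v∣p} ⟨û⟩_v = ∏_w (T_{w,2}⁻¹)^{ord_w u}`; with `det ρ(Frob_w) = q_w x(T_{w,2})` (arithmetic
  Frobenius, `heckeFrobPoly`) and `det ρ = ψ ε^{k-1}` the centre has weight `2 - k`: the registered
  sign of the exponent is RIGHT.
* Every step is proved; the class-field-theoretic finite-order input is the tree's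
  `FramedGaloisRep.exists_idelicCharacter` + `IdelicCharacter.exists_pow_prod_map_localUnits_eq`
  (Serre's product formula), so NO named fact is taken.
* Inputs landed as Literature files (the gate's `supports.stub-mismatch` refuses helper-only
  `--supports` files): `Literature.Algebra.Homology.GroupCohomologyCentralElement`,
  `Literature.NumberTheory.Automorphic.{HidaTowerCentralHecke,TameLevelScalarFactorisation,
  HidaTowerDiamondCentre,HidaTowerDiamondContinuity,GlobalScalarApproximation}`,
  `Literature.NumberTheory.GaloisRepresentations.OrdinaryTwistedDeterminant`; this file = good case +
  density step + the stub.
-/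

/-! ## The case of GOOD `u`

Assembly of the Hecke side (`prod_apply_ordDiamondAt_eq`: `∏_{v ∣ p} x(⟨û⟩_v) = ∏_w x(T_{w,2}⁻¹)^{ord_w u}`),
association (`det_frob_of_isOrdAssociated`: `det ρ(Frob_w) = q_w x(T_{w,2})`), the Galois side
(`exists_pow_prod_frobValue_pow_eq_one` for the twisted determinant `(det ρ · ε^{1-k})^m`, unramified
at `p` by ordinarity and off `S` by association) and `|N(u)| = ∏_w q_w^{ord_w u}`: there is `N ≥ 1`
such that `(∏_{v ∣ p} x(⟨(û_v, û_v)⟩_v))^N = (N_{F/ℚ}(u)^{2-k})^N` for every `u ∈ 𝓞 F ∖ 0` which is a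
unit at ALL bad places and satisfies the congruence condition `ι_w(u · 1) ∈ U` at the bad places off
`p` (`pow_prod_ordDiamondAt_eq_of_good`).  The exponent `N = 2 m N₀` is even, which absorbs the sign
of the norm. [folklore]
-/

set_option linter.dupNamespace false -- `Summit.Langlands.Langlands` is the mandated namespace

namespace Summit.Langlands.Langlands.Theorems.SkinnerWilesDefectOne.CentralDiamondWeight

open Literature.NumberTheory.Automorphic Literature.NumberTheory.Automorphic.BigHeckeGLn
open Literature.NumberTheory.GaloisRepresentations
open NumberField IsDedekindDomain Field

noncomputable section

variable {F : Type} [Field F] [NumberField F] {p : ℕ} [Fact p.Prime]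

/-- **The centre of the diamond character for good `u`.** See the module docstring. [folklore] -/
theorem pow_prod_ordDiamondAt_eq_of_good (𝒰 : TameLevel 2 F p) (h𝒰 : 𝒰.IsMaximalAbove)
    (x : OrdinaryHeckeAlgebraGLn 𝒰 →+* PadicAlgCl p) (ρ : FramedGaloisRep F (PadicAlgCl p) 2) (k m : ℕ)
    (hass : 𝒰.IsOrdAssociated x ρ) (hk : 2 ≤ k) (hm : 0 < m)
    (hord : ∀ v : HeightOneSpectrum (𝓞 F), (p : 𝓞 F) ∈ v.asIdeal → ρ.IsOrdinaryOfWeightAt p v k m) :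
    ∃ N : ℕ, 0 < N ∧ ∀ (u : 𝓞 F) (hu : u ≠ 0)
      (û : ∀ v : HeightOneSpectrum (𝓞 F), (p : 𝓞 F) ∈ v.asIdeal → (v.adicCompletionIntegers F)ˣ),
      (∀ (v : HeightOneSpectrum (𝓞 F)) (hv : (p : 𝓞 F) ∈ v.asIdeal),
        ((û v hv : v.adicCompletionIntegers F) : v.adicCompletion F) = algebraMap F (v.adicCompletion F) (u : F)) →
      (∀ w ∈ 𝒰.bad, ordAt w u = 0) →
      (∀ w ∈ 𝒰.bad, (p : 𝓞 F) ∉ w.asIdeal → ofLocal 2 F w (localScalar w (unitOf u hu)) ∈ 𝒰.subgroup) →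
      (∏ v ∈ placesAbove F p, x (ordDiamondAt 𝒰 û v)) ^ N =
        ((((Algebra.norm ℤ u : ℤ)) : PadicAlgCl p) ^ (2 - (k : ℤ))) ^ N := by
  classical
  set ψ := twistedDetPow p ρ k m with hψ
  set S : Finset (HeightOneSpectrum (𝓞 F)) :=
    𝒰.bad_finite.toFinset.filter (fun w => (p : 𝓞 F) ∉ w.asIdeal) with hSdef
  have hS : ∀ v ∉ S, FramedGaloisRep.IsUnramifiedAt v (FramedRep.ofCharacter ψ) := by
    intro v hv
    by_cases hp : (p : 𝓞 F) ∈ v.asIdeal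
    · exact isUnramifiedAt_twistedDetPow_of_isOrdinaryOfWeightAt p (hord v hp)
    · have hvb : v ∉ 𝒰.bad := fun h =>
        hv (Finset.mem_filter.2 ⟨𝒰.bad_finite.mem_toFinset.2 h, hp⟩)
      exact isUnramifiedAt_twistedDetPow_of_isUnramifiedAt p hp (isUnramifiedAt_of_isOrdAssociated hass hvb) k m
  have hSp : ∀ v ∈ S, (p : 𝓞 F) ∉ v.asIdeal := fun v hv => (Finset.mem_filter.1 hv).2
  have hSb : ∀ v ∈ S, v ∈ 𝒰.bad := fun v hv => 𝒰.bad_finite.mem_toFinset.1 (Finset.mem_filter.1 hv).1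
  obtain ⟨N₀, hN₀, hGal⟩ := exists_pow_prod_frobValue_pow_eq_one p ψ S hS hSp
  refine ⟨2 * m * N₀, by positivity, fun u hu û hû hunit hcong => ?_⟩
  set T := goodSupport 𝒰 u hu with hTdef
  have hT : ∀ w ∈ T, ordAt w u ≠ 0 ∧ w ∉ 𝒰.bad := fun w hw => (mem_goodSupport 𝒰 hu).1 hw
  -- the Hecke side
  have hHecke := prod_apply_ordDiamondAt_eq x h𝒰 hu hû hcong
  have hX : ∀ w ∈ T, x (𝒰.ordT w 2) * x (𝒰.ordTInv w) = 1 := fun w hw => by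
    rw [← map_mul, ordT_self_mul_ordTInv 𝒰 (hT w hw).2, map_one]
  -- the Frobenius values
  set q : HeightOneSpectrum (𝓞 F) → PadicAlgCl p := fun w => ((Ideal.absNorm w.asIdeal : ℕ) : PadicAlgCl p) with hqdef
  have hq0 : ∀ w : HeightOneSpectrum (𝓞 F), q w ≠ 0 := fun w => by
    rw [hqdef, Nat.cast_ne_zero, Ne, Ideal.absNorm_eq_zero_iff]
    exact w.ne_bot
  set φ : HeightOneSpectrum (𝓞 F) → PadicAlgCl p :=
    fun w => (q w * x (𝒰.ordT w 2)) ^ m * (q w ^ ((k - 1) * m))⁻¹ with hφdef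
  have hφ0 : ∀ w ∈ T, φ w ≠ 0 := fun w hw => by
    have hx0 : x (𝒰.ordT w 2) ≠ 0 := left_ne_zero_of_mul_eq_one (hX w hw)
    exact mul_ne_zero (pow_ne_zero _ (mul_ne_zero (hq0 w) hx0)) (inv_ne_zero (pow_ne_zero _ (hq0 w)))
  set f : HeightOneSpectrum (𝓞 F) → (PadicAlgCl p)ˣ :=
    fun w => if h : φ w ≠ 0 then Units.mk0 (φ w) h else 1 with hfdef
  have hf : ∀ w ∈ T, ((f w : (PadicAlgCl p)ˣ) : PadicAlgCl p) = φ w := fun w hw => by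
    rw [hfdef]; simp only [dif_pos (hφ0 w hw), Units.val_mk0]
  have hfrob : ∀ w ∈ T, ∀ 𝔓 ∈ w.primesAbove, ∀ σ : absoluteGaloisGroup F, IsArithFrobAt (𝓞 F) σ 𝔓 → ψ σ = f w := by
    intro w hw 𝔓 h𝔓 σ hσ
    have hwb : w ∉ 𝒰.bad := (hT w hw).2
    have hwp : (p : 𝓞 F) ∉ w.asIdeal := fun h => hwb (𝒰.mem_bad_of_mem w h)
    apply Units.ext
    rw [hf w hw, hψ, coe_twistedDetPow_apply_of_isArithFrobAt p ρ k m hwp h𝔓 hσ,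
      det_frob_of_isOrdAssociated hass hwb h𝔓 hσ]
    rfl
  -- the valuation hypotheses
  have hval0 : ∀ w : HeightOneSpectrum (𝓞 F), w.valuation F ((unitOf u hu : Fˣ) : F) = WithZero.exp (-(ordAt w u : ℤ)) := by
    intro w
    change w.valuation F ((u : 𝓞 F) : F) = _
    rw [HeightOneSpectrum.valuation_of_algebraMap, HeightOneSpectrum.intValuation_if_neg w hu]
    rfl
  have hval : ∀ w ∈ T, Valued.v (algebraMap F (w.adicCompletion F) ((unitOf u hu : Fˣ) : F)) =
      WithZero.exp (-(ordAt w u : ℤ)) := fun w _ => valued_algebraMap_eq w hu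
  have hSu : ∀ v ∈ S, v.valuation F ((unitOf u hu : Fˣ) : F) = 1 := fun v hv => by
    rw [hval0, hunit v (hSb v hv)]; simp
  have hdisj : Disjoint S T := Finset.disjoint_left.2 fun w hwS hwT => (hT w hwT).2 (hSb w hwS)
  have hout : ∀ v ∉ S ∪ T, v.valuation F ((unitOf u hu : Fˣ) : F) = 1 := by
    intro v hv
    rw [Finset.mem_union, not_or] at hv
    have h0 : ordAt v u = 0 := by
      by_cases hb : v ∈ 𝒰.bad
      · exact hunit v hb
      · by_contra h
        exact hv.2 ((mem_goodSupport 𝒰 hu).2 ⟨h, hb⟩)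
    rw [hval0, h0]; simp
  have key := hGal (unitOf u hu) T (fun w => ordAt w u) f hSu hdisj hout hval hfrob
  have keyA : (∏ w ∈ T, φ w ^ ordAt w u) ^ N₀ = 1 := by
    have h := congrArg (fun z : (PadicAlgCl p)ˣ => (z : PadicAlgCl p)) key
    simp only [Units.val_pow_eq_pow_val, Units.val_one, Units.coe_prod] at h
    rw [Finset.prod_congr rfl fun w hw => by rw [hf w hw]] at h
    exact h
  -- the algebra
  set Q := ∏ w ∈ T, q w ^ ordAt w u with hQdef
  set Xp := ∏ w ∈ T, x (𝒰.ordT w 2) ^ ordAt w u with hXpdef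
  have hYX : (∏ w ∈ T, x (𝒰.ordTInv w) ^ ordAt w u) * Xp = 1 := by
    rw [hXpdef, ← Finset.prod_mul_distrib]
    exact Finset.prod_eq_one fun w hw => by rw [← mul_pow, mul_comm, hX w hw, one_pow]
  have hQ0 : Q ≠ 0 := Finset.prod_ne_zero_iff.2 fun w _ => pow_ne_zero _ (hq0 w)
  have hQnorm : Q = ((|Algebra.norm ℤ u| : ℤ) : PadicAlgCl p) := prod_goodSupport_natCast_absNorm_pow_ordAt 𝒰 hu hunit
  have hE1 : ∏ w ∈ T, φ w ^ ordAt w u = Q ^ m * Xp ^ m * (Q ^ ((k - 1) * m))⁻¹ := by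
    rw [hQdef, hXpdef, ← Finset.prod_pow, ← Finset.prod_pow, ← Finset.prod_pow, ← Finset.prod_mul_distrib,
      ← Finset.prod_inv_distrib, ← Finset.prod_mul_distrib]
    refine Finset.prod_congr rfl fun w _ => ?_
    rw [hφdef]
    dsimp only
    ring
  obtain ⟨j, rfl⟩ : ∃ j, k = j + 2 := ⟨k - 2, by omega⟩
  have hE2 : Xp ^ (m * N₀) = Q ^ (j * m * N₀) := by
    have h3 : (Q ^ m * Xp ^ m) ^ N₀ = (Q ^ ((j + 2 - 1) * m)) ^ N₀ := by
      rw [hE1, mul_pow, inv_pow, mul_inv_eq_one₀ (pow_ne_zero _ (pow_ne_zero _ hQ0))] at keyA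
      exact keyA
    apply mul_left_cancel₀ (pow_ne_zero (m * N₀) hQ0)
    calc Q ^ (m * N₀) * Xp ^ (m * N₀) = (Q ^ m * Xp ^ m) ^ N₀ := by ring
      _ = (Q ^ ((j + 2 - 1) * m)) ^ N₀ := h3
      _ = Q ^ (m * N₀) * Q ^ (j * m * N₀) := by rw [show j + 2 - 1 = j + 1 from rfl]; ring
  rw [hHecke, eq_inv_of_mul_eq_one_left hYX]
  have hnorm2 : (((Algebra.norm ℤ u : ℤ)) : PadicAlgCl p) ^ 2 = Q ^ 2 := by
    rw [hQnorm, ← Int.cast_pow, ← Int.cast_pow, sq_abs]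
  have hk' : (2 : ℤ) - ((j + 2 : ℕ) : ℤ) = -((j : ℕ) : ℤ) := by push_cast; ring
  rw [hk', zpow_neg, zpow_natCast, inv_pow, inv_pow]
  congr 1
  calc Xp ^ (2 * m * N₀) = (Xp ^ (m * N₀)) ^ 2 := by ring
    _ = (Q ^ (j * m * N₀)) ^ 2 := by rw [hE2]
    _ = (Q ^ 2) ^ (j * m * N₀) := by ring
    _ = ((((Algebra.norm ℤ u : ℤ)) : PadicAlgCl p) ^ 2) ^ (j * m * N₀) := by rw [hnorm2]
    _ = ((((Algebra.norm ℤ u : ℤ)) : PadicAlgCl p) ^ j) ^ (2 * m * N₀) := by ring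

end

end Summit.Langlands.Langlands.Theorems.SkinnerWilesDefectOne.CentralDiamondWeight

set_option linter.dupNamespace false -- `Summit.Langlands.Langlands` is the mandated namespace

namespace Summit.Langlands.Langlands.Cruxes.ProModularOrdinaryClassical.TopDegreeExactControl

open Summit.Langlands.Langlands.Theorems.SkinnerWilesDefectOne.CentralDiamondWeight Literature.Algebra.Homology
-- buildfix 2026-08-19 (ops-buildfix lane): the former `open …ProModularOrdinaryClassical.Negative (norm_natCast_padicAlgCl)`
-- became ambiguous with the Literature lemma of the same name (`Literature.NumberTheory.GaloisRepresentations`);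
-- the single use below is now fully qualified.
open Literature.NumberTheory.Automorphic Literature.NumberTheory.Automorphic.BigHeckeGLn
open Literature.NumberTheory.GaloisRepresentations
open NumberField IsDedekindDomain Filter Topology

/-- **Stub 2a of the line `top-degree-exact-control`: the CENTRE of the diamond character of a
continuous ordinary point associated with a Galois-ordinary `ρ` of parallel weight `k` is
`N_{F/ℚ}(u)^{2-k}` up to `N`-th powers.** See the module docstring for the proof. [folklore] -/
theorem stub_centralDiamondWeight : ∀ (F : Type) [Field F] [NumberField F], NumberField.IsTotallyComplex F → Module.finrank ℚ F = 2 → ∀ (p : ℕ) [Fact p.Prime], p ≠ 2 → ∀ (ρ : Literature.NumberTheory.GaloisRepresentations.FramedGaloisRep F (PadicAlgCl p) 2) (𝒰 : Literature.NumberTheory.Automorphic.BigHeckeGLn.TameLevel 2 F p) (x : Literature.NumberTheory.Automorphic.OrdinaryHeckeAlgebraGLn 𝒰 →+* PadicAlgCl p) (k m : ℕ), ρ.toGaloisRep.IsIrreducible → 𝒰.IsMaximalAbove → Continuous x → 𝒰.IsOrdAssociated x ρ → 2 ≤ k → 0 < m → (∀ v : IsDedekindDomain.HeightOneSpectrum (NumberField.RingOfIntegers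 F), (p : NumberField.RingOfIntegers F) ∈ v.asIdeal → ρ.IsOrdinaryOfWeightAt p v k m) → ∃ N : ℕ, 0 < N ∧ ∀ (u : NumberField.RingOfIntegers F) (û : ∀ v : IsDedekindDomain.HeightOneSpectrum (NumberField.RingOfIntegers F), (p : NumberField.RingOfIntegers F) ∈ v.asIdeal → (v.adicCompletionIntegers F)ˣ), (∀ (v : IsDedekindDomain.HeightOneSpectrum (NumberField.RingOfIntegers F)) (hv : (p : NumberField.RingOfIntegers F) ∈ v.asIdeal), ((û v hv : v.adicCompletionIntegers F) : v.adicCompletion F) = algebraMap F (v.adicCompletion F) (u : F)) → (∏ᶠ v : {v : IsDedekindDomain.HeightOneSpectrum (NumberField.RingOfIntegers F) // (p : NumberField.RingOfIntegers F) ∈ v.asIdeal}, x (𝒰.ordDiamond v.2 (fun _ : Fin 2 => û v.1 v.2))) ^ N = (((Algebra.norm ℤ u : ℤ) : PadicAlgCl p) ^ (2 - (k : ℤ))) ^ N := by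
  intro F _ _ _ _ p _ _ ρ 𝒰 x k m _ h𝒰 hx hass hk hm hord
  classical
  obtain ⟨N, hN, hgood⟩ := pow_prod_ordDiamondAt_eq_of_good 𝒰 h𝒰 x ρ k m hass hk hm hord
  refine ⟨N, hN, fun u û hû => ?_⟩
  obtain ⟨v₀, hv₀⟩ := exists_mem_asIdeal_natCast (F := F) p
  have hu0 : u ≠ 0 := by
    intro h
    have h1 := valued_coe_units_adicCompletionIntegers v₀ (û v₀ hv₀)
    rw [hû v₀ hv₀, h] at h1
    simp at h1
  obtain ⟨c, hc⟩ := exists_forall_ofLocal_mem 𝒰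
  -- approximation of `u` by good integers `y B`
  have hCRT : ∀ B : ℕ, ∃ y : 𝓞 F,
      (∀ v : HeightOneSpectrum (𝓞 F), (p : 𝓞 F) ∈ v.asIdeal → y - u ∈ v.asIdeal ^ (ordAt v (p : 𝓞 F) * B + B + 1)) ∧
      (∀ w ∈ 𝒰.bad, (p : 𝓞 F) ∉ w.asIdeal → y - 1 ∈ w.asIdeal ^ (c + 1)) := by
    intro B
    obtain ⟨y, hy⟩ := IsDedekindDomain.exists_forall_sub_mem_ideal (s := 𝒰.bad_finite.toFinset)
      (fun v : HeightOneSpectrum (𝓞 F) => v.asIdeal)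
      (fun v => if (p : 𝓞 F) ∈ v.asIdeal then ordAt v (p : 𝓞 F) * B + B + 1 else c + 1)
      (fun v _ => v.prime) (fun v _ w _ hvw h => hvw (HeightOneSpectrum.ext h))
      (fun v => if (p : 𝓞 F) ∈ v.1.asIdeal then u else 1)
    refine ⟨y, fun v hv => ?_, fun w hw hwp => ?_⟩
    · have h := hy v (𝒰.bad_finite.mem_toFinset.2 (𝒰.mem_bad_of_mem v hv))
      simp only [if_pos hv] at h
      exact h
    · have h := hy w (𝒰.bad_finite.mem_toFinset.2 hw)
      simp only [if_neg hwp] at h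
      exact h
  choose y hyP hyB using hCRT
  have hcoe : ∀ (a b : 𝓞 F), (((a - b : 𝓞 F)) : F) = (a : F) - (b : F) := fun a b => by push_cast; rfl
  have hunits : ∀ (B : ℕ) (v : HeightOneSpectrum (𝓞 F)) (hv : (p : 𝓞 F) ∈ v.asIdeal),
      ∃ b : (v.adicCompletionIntegers F)ˣ,
        ((b : v.adicCompletionIntegers F) : v.adicCompletion F) = algebraMap F (v.adicCompletion F) (y B : F) ∧
        Valued.v (((((û v hv)⁻¹ * b : (v.adicCompletionIntegers F)ˣ) : v.adicCompletionIntegers F) :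
          v.adicCompletion F) - 1) ≤ WithZero.exp (-((ordAt v (p : 𝓞 F) * B + B + 1 : ℕ) : ℤ)) := by
    intro B v hv
    refine exists_unit_eq_of_valued_sub_le (û v hv) _ (by omega) ?_
    rw [hû v hv, ← map_sub, ← hcoe]
    exact valued_algebraMap_le_of_mem_pow (hyP B v hv)
  choose ŷ hŷ hŷr using hunits
  have hy0 : ∀ B, y B ≠ 0 := by
    intro B h
    have h1 := valued_coe_units_adicCompletionIntegers v₀ (ŷ B v₀ hv₀)
    rw [hŷ, h] at h1
    simp at h1
  have hyunit : ∀ B, ∀ w ∈ 𝒰.bad, ordAt w (y B) = 0 := by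
    intro B w hw
    by_cases hwp : (p : 𝓞 F) ∈ w.asIdeal
    · have h1 := valued_coe_units_adicCompletionIntegers w (ŷ B w hwp)
      rw [hŷ, valued_algebraMap_eq w (hy0 B), ← WithZero.exp_zero, WithZero.exp_inj] at h1
      omega
    · by_contra hne
      have hymem : y B ∈ w.asIdeal := Ideal.dvd_span_singleton.1 ((ordAt_ne_zero_iff w (hy0 B)).1 hne)
      have h1 : y B - 1 ∈ w.asIdeal := Ideal.pow_le_self (by omega) (hyB B w hw hwp)
      have h2 : (1 : 𝓞 F) ∈ w.asIdeal := by simpa using sub_mem hymem h1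
      exact w.isPrime.ne_top ((Ideal.eq_top_iff_one _).2 h2)
  have hycong : ∀ B, ∀ w ∈ 𝒰.bad, (p : 𝓞 F) ∉ w.asIdeal →
      ofLocal 2 F w (localScalar w (unitOf (y B) (hy0 B))) ∈ 𝒰.subgroup := by
    intro B w hw hwp
    refine hc w hw _ (localCongruenceSubgroup_antitone 2 F w (Nat.le_succ c) ?_)
    refine localScalar_mem_localCongruenceSubgroup w _ (by omega) ?_
    change Valued.v (algebraMap F (w.adicCompletion F) ((y B : 𝓞 F) : F) - 1) ≤ _
    have h := valued_algebraMap_le_of_mem_pow (hyB B w hw hwp)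
    rwa [hcoe, map_sub, show (((1 : 𝓞 F)) : F) = 1 from rfl, map_one] at h
  have hgoodB : ∀ B, (∏ v ∈ placesAbove F p, x (ordDiamondAt 𝒰 (ŷ B) v)) ^ N =
      ((((Algebra.norm ℤ (y B) : ℤ)) : PadicAlgCl p) ^ (2 - (k : ℤ))) ^ N :=
    fun B => hgood (y B) (hy0 B) (ŷ B) (fun v hv => hŷ B v hv) (hyunit B) (hycong B)
  -- the limit of the left-hand sides
  have hL : Tendsto (fun B => ∏ v ∈ placesAbove F p, x (ordDiamondAt 𝒰 (ŷ B) v)) atTop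
      (𝓝 (∏ v ∈ placesAbove F p, x (ordDiamondAt 𝒰 û v))) := by
    refine tendsto_finsetProd _ fun v hv => ?_
    have hvp : (p : 𝓞 F) ∈ v.asIdeal := mem_placesAbove.1 hv
    have hsplit : ∀ B, x (ordDiamondAt 𝒰 (ŷ B) v) =
        x (ordDiamondAt 𝒰 û v) * x (𝒰.ordDiamond hvp (fun _ : Fin 2 => (û v hvp)⁻¹ * ŷ B v hvp)) := by
      intro B
      have hfun : (fun _ : Fin 2 => ŷ B v hvp) =
          (fun _ : Fin 2 => û v hvp) * (fun _ : Fin 2 => (û v hvp)⁻¹ * ŷ B v hvp) := by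
        funext j
        simp only [Pi.mul_apply, mul_inv_cancel_left]
      rw [ordDiamondAt_of_mem _ hvp, ordDiamondAt_of_mem _ hvp]
      change x (𝒰.ordDiamondHom h𝒰 hvp (fun _ : Fin 2 => ŷ B v hvp)) =
        x (𝒰.ordDiamondHom h𝒰 hvp (fun _ : Fin 2 => û v hvp)) *
          x (𝒰.ordDiamondHom h𝒰 hvp (fun _ : Fin 2 => (û v hvp)⁻¹ * ŷ B v hvp))
      rw [hfun, map_mul, map_mul]
    rw [show (fun B => x (ordDiamondAt 𝒰 (ŷ B) v)) = fun B => x (ordDiamondAt 𝒰 û v) *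
        x (𝒰.ordDiamond hvp (fun _ : Fin 2 => (û v hvp)⁻¹ * ŷ B v hvp)) from funext hsplit]
    have h1 : Tendsto (fun B => x (𝒰.ordDiamond hvp (fun _ : Fin 2 => (û v hvp)⁻¹ * ŷ B v hvp))) atTop (𝓝 1) := by
      refine tendsto_apply_ordDiamond x hx h𝒰 hvp (fun B => fun _ : Fin 2 => (û v hvp)⁻¹ * ŷ B v hvp) fun B j => ?_
      refine (hŷr B v hvp).trans ?_
      rw [WithZero.exp_le_exp]
      push_cast
      nlinarith [Nat.zero_le (ordAt v (p : 𝓞 F) * B)]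
    have h2 := h1.const_mul (x (ordDiamondAt 𝒰 û v))
    rwa [mul_one] at h2
  -- the limit of the right-hand sides
  have hnorm0 : ((Algebra.norm ℤ u : ℤ) : PadicAlgCl p) ≠ 0 := by
    exact_mod_cast (Algebra.norm_ne_zero_iff.2 hu0)
  have hp1 : (1 : ℝ) < p := Nat.one_lt_cast.2 (Fact.out : p.Prime).one_lt
  have hR : Tendsto (fun B => (((Algebra.norm ℤ (y B) : ℤ)) : PadicAlgCl p)) atTop
      (𝓝 (((Algebra.norm ℤ u : ℤ)) : PadicAlgCl p)) := by
    rw [Metric.tendsto_atTop]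
    intro ε hε
    obtain ⟨B₀, hB₀⟩ : ∃ B₀ : ℕ, ((p : ℝ)⁻¹) ^ B₀ < ε := exists_pow_lt_of_lt_one hε (inv_lt_one_of_one_lt₀ hp1)
    refine ⟨B₀, fun B hB => ?_⟩
    have hdvd : ((p ^ B : ℕ) : ℤ) ∣ Algebra.norm ℤ (y B) - Algebra.norm ℤ u :=
      dvd_norm_sub_norm_of_sub_mem (mem_span_natCast_pow_of_forall p B fun v hv =>
        Ideal.pow_le_pow_right (by nlinarith [Nat.zero_le (ordAt v (p : 𝓞 F) * B)]) (hyP B v hv))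
    obtain ⟨cz, hcz⟩ := hdvd
    have hint : ‖((cz : ℤ) : PadicAlgCl p)‖ ≤ 1 := by
      rw [← map_intCast (algebraMap ℚ_[p] (PadicAlgCl p)) cz, PadicAlgCl.norm_extends]
      exact Padic.norm_int_le_one cz
    rw [dist_eq_norm, ← Int.cast_sub, hcz, Int.cast_mul, Int.cast_natCast, Nat.cast_pow, norm_mul, norm_pow,
      Summit.Langlands.Langlands.Theorems.ProModularOrdinaryClassical.Negative.norm_natCast_padicAlgCl]
    refine lt_of_le_of_lt ?_ hB₀
    refine (mul_le_of_le_one_right (pow_nonneg (inv_nonneg.2 (Nat.cast_nonneg p)) _) hint).trans ?_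
    exact pow_le_pow_of_le_one (inv_nonneg.2 (Nat.cast_nonneg p)) (inv_le_one_of_one_le₀ hp1.le) hB
  have hRz : Tendsto (fun B => ((((Algebra.norm ℤ (y B) : ℤ)) : PadicAlgCl p) ^ (2 - (k : ℤ))) ^ N) atTop
      (𝓝 (((((Algebra.norm ℤ u : ℤ)) : PadicAlgCl p) ^ (2 - (k : ℤ))) ^ N)) :=
    (((continuousAt_zpow₀ _ (2 - (k : ℤ)) (Or.inl hnorm0)).tendsto.comp hR).pow N)
  have hLN := hL.pow N
  rw [show (fun B => (∏ v ∈ placesAbove F p, x (ordDiamondAt 𝒰 (ŷ B) v)) ^ N) =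
      fun B => ((((Algebra.norm ℤ (y B) : ℤ)) : PadicAlgCl p) ^ (2 - (k : ℤ))) ^ N from funext hgoodB] at hLN
  have hfinal := tendsto_nhds_unique hLN hRz
  -- rewrite the finite product over the subtype
  haveI : Fintype {v : HeightOneSpectrum (𝓞 F) // (p : 𝓞 F) ∈ v.asIdeal} :=
    (finite_setOf_natCast_mem_asIdeal F p).fintype
  have hprod : ∏ᶠ v : {v : HeightOneSpectrum (𝓞 F) // (p : 𝓞 F) ∈ v.asIdeal},
      x (𝒰.ordDiamond v.2 (fun _ : Fin 2 => û v.1 v.2)) = ∏ v ∈ placesAbove F p, x (ordDiamondAt 𝒰 û v) := by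
    rw [finprod_eq_prod_of_fintype, Finset.prod_subtype (placesAbove F p) (fun v => mem_placesAbove)
      (fun v => x (ordDiamondAt 𝒰 û v))]
    refine Finset.prod_congr rfl fun v _ => ?_
    rw [ordDiamondAt_of_mem _ v.2]
  rw [hprod]
  exact hfinal

end Summit.Langlands.Langlands.Cruxes.ProModularOrdinaryClassical.TopDegreeExactControl
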